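import Summits.ResolutionOfSingularities.ResolutionOfSingularities.Theorems.HomologicalConductorNoZenoConfinedSurfaceTrichotomy
import Literature.AlgebraicGeometry.Resolution.QuasiExcellentSchemes
import Literature.AlgebraicGeometry.Morphisms.CechH2FibreDimOne
import Literature.AlgebraicGeometry.Resolution.Lipman1969RationalSurfaceSingularities
import Literature.AlgebraicGeometry.Resolution.Lipman1969FormallySmoothBaseChange
import Literature.AlgebraicGeometry.Resolution.Lipman1969RationalContraction
import HarnessLib

/-!
# Crux `NoZenoR` (stmt-ResolutionOfSingularities-19943), slot 2 `stub_beta1RankOneSharpF`: the line `confined-surface` IN THE TREE, part 2 —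
# β1ʳ¹♯ (the registered slot text) from THREE NAMED RESIDUALS (Shannon transfer · the exhaustive branch · the sharp surface-confined residual)

OURS (cell res-hironaka, crux chain W4.4; line `confined-surface` r1 by res-L0-w44-strat-1 g11, 2e9a6b4082d4a94d; trace-socle facts 1–4 by
res-L0-w44-idea-1, ported to `Theorems.NoZeno.TraceSocle` by res-L0-w44-stub-1 (p540464, p541310, p542128, p543974); tree port of the line by the
lead res-L0-w44-lead-1 g9, DESK WORD 36).  AI-written, weaker than expert review; nothing here is a statement of the manuscript under review
(Hironaka 2017).  SUPPORT-level, counted 0.  DEF-FREE: the three residuals and the registered slot text are written out VERBATIM as binder /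
conclusion texts (the line file's `Sig.ShannonTransferSharp`, `Sig.Beta1SharpExhaustive`, `Sig.SurfaceConfinedResidualSharp`,
`Sig.SurfaceConfinedResidual`, `Sig.Beta1SharpConfined` with `Sig.Confined` unfolded, and the registered v28–v33 text
`Cruxes.NoZeno.Lines.Coarsening.Sig.stub_beta1RankOneSharp`); the four trace-socle facts are DISCHARGED BY NAME (`TraceSocle.exists_traceDominator`,
`TraceSocle.terminates_of_noetherianResidualDominator`, `TraceSocle.curveCoarsening_terminates`, `TraceSocle.curveTrace_terminates`).

THE CUT (K-level).  β1ʳ¹♯ binders (kernel `hker`, maximality, IH in smaller tr.deg, `hzd`, `3 ≤ tr.deg`, RANK ONE), branch (b) (an unreachable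
residually transcendental `t ∈ O`), THREADLESS, and the tail CONFINED by a valuation ring `W ⊇ T_(m₁)` (escape witness `s⁻¹ ∈ W ∖ O`, some
`t⁻¹ ∉ W`, all later stages inside `loc W (T_(m₁))`).  A TRACE DOMINATOR is a valuation ring `U ≤ W` dominating the tower; one exists
(fact 1 + `TraceSocle.dominates_residueLift`).  TRICHOTOMY: (i) the image of `U` in `κ(W)` is noetherian ⇒ the tower terminates (fact 2;
`terminates_of_noetherianImage`); (ii) some intermediate `U < W₂ < W ∋ k` of residual transcendence degree `≤ 1` does not dominate ⇒ the
tower terminates (dominance invariance + threadless transfer + fact 3; `terminates_of_lowResidueIntermediate`); (iii) the RESIDUAL: every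
trace dominator has non-noetherian image and every low-residue intermediate dominates.  SHARP FORM: one more binder — two stage elements
with algebraically independent `W`-residues — at the price of fact 4 (`surfaceConfinedResidual_of_sharp`).  Registry level:
`beta1RankOneSharp_of_split` (exhaustive data → the exhaustive residual; confined branch-(b) data → the confined branch; unconfined
branch-(b) data contradict Shannon transfer) and **`beta1RankOneSharpF_of_residuals`**: the three residuals imply the registered type of
`stub_beta1RankOneSharpF` (`Sig.FactsW` unfolded → the slot text), the facts prefix being unused.  The three residuals are genuine
conjectures of this programme (no close is claimed); every later closer of slot 2 is BY NAME against this file.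

References: W. Heinzer et al., arXiv:1505.06445 (Shannon's non-switching case); K. Kiyek, J. L. Vicente, *Resolution of curve and surface
singularities*, VIII (4.2), (4.4), (7.9); O. Zariski 1939.
-/

noncomputable section

-- single-problem summit: the doubled namespace component `ResolutionOfSingularities` is forced
set_option linter.dupNamespace false

namespace Summit.ResolutionOfSingularities.ResolutionOfSingularities.Theorems.NoZeno.ConfinedSurface

open Summit.ResolutionOfSingularities.ResolutionOfSingularities.Theses.HomologicalConductor
open Summit.ResolutionOfSingularities.ResolutionOfSingularities.Theorems.NoZeno.Birth
open Summit.ResolutionOfSingularities.ResolutionOfSingularities.Theorems.NoZeno.SandwichCluster.Parasite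
open Summit.ResolutionOfSingularities.ResolutionOfSingularities.Theorems
open Summit.ResolutionOfSingularities.ResolutionOfSingularities.Theorems.NoZeno
open Summit.ResolutionOfSingularities.ResolutionOfSingularities.Theorems.NoZeno.TraceSocle
  (stage_le inv_mem_stage loc_le dominates_residueLift exists_traceDominator terminates_of_noetherianResidualDominator
   curveCoarsening_terminates curveTrace_terminates)
open Literature.AlgebraicGeometry.Resolution
open IsLocalRing

variable {k K : Type} [Field k] [Field K] [Algebra k K]

/-! ## §6 (PROVED) Registry level: β1ʳ¹♯ from Shannon transfer, the exhaustive residual and the confined branch -/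

/-- **β1ʳ¹♯ ⟸ Shannon transfer ∧ the exhaustive residual ∧ the confined branch** (idea-1's split with the curve-confined case absorbed:
exhaustive data → the exhaustive residual; confined branch-(b) data → the confined branch; unconfined branch-(b) data contradict Shannon
transfer, `t` being unreachable).  Binders: `h₁` = `Sig.ShannonTransferSharp`, `h₂` = `Sig.Beta1SharpExhaustive`, `h₃` = `Sig.Beta1SharpConfined`;
conclusion = the registered text `Coarsening.Sig.stub_beta1RankOneSharp`. [this work] -/
theorem beta1RankOneSharp_of_split
    (h₁ :
      PersistenceRadical → StrictDrop → ∀ p : ℕ, p.Prime → ∀ (k K : Type) [Field k] [CharP k p] [Field K]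
        [Algebra k K] (O : ValuationSubring K) (A : Subalgebra k K), (∀ c : k, algebraMap k K c ∈ O) →
        A.FG → IsFractionRing ↥A K → A.toSubring ≤ O.toSubring →
        (∀ O' : ValuationSubring K,
          (∀ m : ℕ, ∀ s ∈ tower O A m, s ∈ O' ∧ (s⁻¹ ∈ O' → s⁻¹ ∈ O)) → ¬ IsNoetherianRing ↥O') →
        (∀ O' : ValuationSubring K, O < O' → ∃ m : ℕ, ∃ s ∈ tower O A m, s⁻¹ ∈ O' ∧ s⁻¹ ∉ O) →
        (∀ (k' K' : Type) [Field k'] [CharP k' p] [Field K'] [Algebra k' K'] (O' : ValuationSubring K')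
          (A' : Subalgebra k' K'), (∀ c : k', algebraMap k' K' c ∈ O') → A'.FG → IsFractionRing ↥A' K' →
          A'.toSubring ≤ O'.toSubring → Algebra.trdeg k' K' < Algebra.trdeg k K →
          ∃ m : ℕ, IsRegularLocalRing ↥(tower O' A' m)) →
        (∀ m : ℕ, ∀ s ∈ tower O A m, ∃ f : Polynomial k, f ≠ 0 ∧ O.valuation (Polynomial.aeval s f) < 1) →
        3 ≤ Algebra.trdeg k K →
        (∀ O₁ : ValuationSubring K, O < O₁ → O₁ = ⊤) →
        ¬ (∃ W : ValuationSubring K, ∃ m₁ : ℕ, (∀ s ∈ tower O A m₁, s ∈ W) ∧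
        (∃ s ∈ tower O A m₁, s⁻¹ ∈ W ∧ s⁻¹ ∉ O) ∧ (∃ t ∈ tower O A m₁, t ≠ 0 ∧ t⁻¹ ∉ W) ∧
        ∀ m : ℕ, m₁ ≤ m → tower O A m ≤ loc W (tower O A m₁)) →
        ¬ SingularPrimeThread O A →
        ∀ x : K, x ∈ O → ∃ m : ℕ, x ∈ tower O A m)
    (h₂ :
      PersistenceRadical → StrictDrop → ∀ p : ℕ, p.Prime → ∀ (k K : Type) [Field k] [CharP k p] [Field K]
        [Algebra k K] (O : ValuationSubring K) (A : Subalgebra k K), (∀ c : k, algebraMap k K c ∈ O) →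
        A.FG → IsFractionRing ↥A K → A.toSubring ≤ O.toSubring →
        (∀ O' : ValuationSubring K,
          (∀ m : ℕ, ∀ s ∈ tower O A m, s ∈ O' ∧ (s⁻¹ ∈ O' → s⁻¹ ∈ O)) → ¬ IsNoetherianRing ↥O') →
        (∀ O' : ValuationSubring K, O < O' → ∃ m : ℕ, ∃ s ∈ tower O A m, s⁻¹ ∈ O' ∧ s⁻¹ ∉ O) →
        (∀ (k' K' : Type) [Field k'] [CharP k' p] [Field K'] [Algebra k' K'] (O' : ValuationSubring K')
          (A' : Subalgebra k' K'), (∀ c : k', algebraMap k' K' c ∈ O') → A'.FG → IsFractionRing ↥A' K' →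
          A'.toSubring ≤ O'.toSubring → Algebra.trdeg k' K' < Algebra.trdeg k K →
          ∃ m : ℕ, IsRegularLocalRing ↥(tower O' A' m)) →
        (∀ m : ℕ, ∀ s ∈ tower O A m, ∃ f : Polynomial k, f ≠ 0 ∧ O.valuation (Polynomial.aeval s f) < 1) →
        3 ≤ Algebra.trdeg k K →
        (∀ O₁ : ValuationSubring K, O < O₁ → O₁ = ⊤) →
        (∀ x : K, x ∈ O → ∃ m : ℕ, x ∈ tower O A m) →
        ¬ SingularPrimeThread O A →
        ∃ m : ℕ, IsRegularLocalRing ↥(tower O A m))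
    (h₃ :
      PersistenceRadical → StrictDrop → ∀ p : ℕ, p.Prime → ∀ (k K : Type) [Field k] [CharP k p] [Field K]
        [Algebra k K] (O : ValuationSubring K) (A : Subalgebra k K), (∀ c : k, algebraMap k K c ∈ O) →
        A.FG → IsFractionRing ↥A K → A.toSubring ≤ O.toSubring →
        (∀ O' : ValuationSubring K,
          (∀ m : ℕ, ∀ s ∈ tower O A m, s ∈ O' ∧ (s⁻¹ ∈ O' → s⁻¹ ∈ O)) → ¬ IsNoetherianRing ↥O') →
        (∀ O' : ValuationSubring K, O < O' → ∃ m : ℕ, ∃ s ∈ tower O A m, s⁻¹ ∈ O' ∧ s⁻¹ ∉ O) →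
        (∀ (k' K' : Type) [Field k'] [CharP k' p] [Field K'] [Algebra k' K'] (O' : ValuationSubring K')
          (A' : Subalgebra k' K'), (∀ c : k', algebraMap k' K' c ∈ O') → A'.FG → IsFractionRing ↥A' K' →
          A'.toSubring ≤ O'.toSubring → Algebra.trdeg k' K' < Algebra.trdeg k K →
          ∃ m : ℕ, IsRegularLocalRing ↥(tower O' A' m)) →
        (∀ m : ℕ, ∀ s ∈ tower O A m, ∃ f : Polynomial k, f ≠ 0 ∧ O.valuation (Polynomial.aeval s f) < 1) →
        3 ≤ Algebra.trdeg k K →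
        (∀ O₁ : ValuationSubring K, O < O₁ → O₁ = ⊤) →
        (∃ t : K, t ∈ O ∧ (∀ m : ℕ, t ∉ tower O A m) ∧
          ∀ f : Polynomial k, f ≠ 0 → ¬ O.valuation (Polynomial.aeval t f) < 1) →
        (∃ W : ValuationSubring K, ∃ m₁ : ℕ, (∀ s ∈ tower O A m₁, s ∈ W) ∧
        (∃ s ∈ tower O A m₁, s⁻¹ ∈ W ∧ s⁻¹ ∉ O) ∧ (∃ t ∈ tower O A m₁, t ≠ 0 ∧ t⁻¹ ∉ W) ∧
        ∀ m : ℕ, m₁ ≤ m → tower O A m ≤ loc W (tower O A m₁)) →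
        ¬ SingularPrimeThread O A →
        ∃ m : ℕ, IsRegularLocalRing ↥(tower O A m)) :
    PersistenceRadical → StrictDrop → ∀ p : ℕ, p.Prime → ∀ (k K : Type) [Field k] [CharP k p] [Field K]
      [Algebra k K] (O : ValuationSubring K) (A : Subalgebra k K), (∀ c : k, algebraMap k K c ∈ O) →
      A.FG → IsFractionRing ↥A K → A.toSubring ≤ O.toSubring →
      (∀ O' : ValuationSubring K,
        (∀ m : ℕ, ∀ s ∈ tower O A m, s ∈ O' ∧ (s⁻¹ ∈ O' → s⁻¹ ∈ O)) → ¬ IsNoetherianRing ↥O') →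
      (∀ O' : ValuationSubring K, O < O' → ∃ m : ℕ, ∃ s ∈ tower O A m, s⁻¹ ∈ O' ∧ s⁻¹ ∉ O) →
      (∀ (k' K' : Type) [Field k'] [CharP k' p] [Field K'] [Algebra k' K'] (O' : ValuationSubring K')
        (A' : Subalgebra k' K'), (∀ c : k', algebraMap k' K' c ∈ O') → A'.FG → IsFractionRing ↥A' K' →
        A'.toSubring ≤ O'.toSubring → Algebra.trdeg k' K' < Algebra.trdeg k K →
        ∃ m : ℕ, IsRegularLocalRing ↥(tower O' A' m)) →
      (∀ m : ℕ, ∀ s ∈ tower O A m, ∃ f : Polynomial k, f ≠ 0 ∧ O.valuation (Polynomial.aeval s f) < 1) →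
      3 ≤ Algebra.trdeg k K →
      (∀ O₁ : ValuationSubring K, O < O₁ → O₁ = ⊤) →
      ((∀ x : K, x ∈ O → ∃ m : ℕ, x ∈ tower O A m) ∨
        (∃ t : K, t ∈ O ∧ (∀ m : ℕ, t ∉ tower O A m) ∧
          ∀ f : Polynomial k, f ≠ 0 → ¬ O.valuation (Polynomial.aeval t f) < 1)) →
      ¬ SingularPrimeThread O A →
      ∃ m : ℕ, IsRegularLocalRing ↥(tower O A m) := by
  intro hP hD p hp k K _ _ _ _ O A hk hA hfr hAO hker hmax IH hzd htr hr1 hNF hthr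
  classical
  rcases hNF with hexh | hb
  · exact h₂ hP hD p hp k K O A hk hA hfr hAO hker hmax IH hzd htr hr1 hexh hthr
  by_cases hconf : (∃ W : ValuationSubring K, ∃ m₁ : ℕ, (∀ s ∈ tower O A m₁, s ∈ W) ∧
    (∃ s ∈ tower O A m₁, s⁻¹ ∈ W ∧ s⁻¹ ∉ O) ∧ (∃ t ∈ tower O A m₁, t ≠ 0 ∧ t⁻¹ ∉ W) ∧
    ∀ m : ℕ, m₁ ≤ m → tower O A m ≤ loc W (tower O A m₁))
  · exact h₃ hP hD p hp k K O A hk hA hfr hAO hker hmax IH hzd htr hr1 hb hconf hthr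
  · obtain ⟨t, htO, htT, -⟩ := hb
    obtain ⟨m, hm⟩ := h₁ hP hD p hp k K O A hk hA hfr hAO hker hmax IH hzd htr hr1 hconf hthr t htO
    exact absurd hm (htT m)

/-- **SLOT 2 FROM THE THREE NAMED RESIDUALS.**  The registered type of `stub_beta1RankOneSharpF` (v29–v33: `Sig.FactsW →
Coarsening.Sig.stub_beta1RankOneSharp`, here with `Sig.FactsW` UNFOLDED to its ten printed theorems) from `Sig.ShannonTransferSharp` (`h₁`),
`Sig.Beta1SharpExhaustive` (`h₂`) and the SHARP surface-confined residual `Sig.SurfaceConfinedResidualSharp` (`h₃`); the facts prefix is not used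
(the trace-socle facts are OURS and proved). [this work] -/
theorem beta1RankOneSharpF_of_residuals
    (h₁ :
      PersistenceRadical → StrictDrop → ∀ p : ℕ, p.Prime → ∀ (k K : Type) [Field k] [CharP k p] [Field K]
        [Algebra k K] (O : ValuationSubring K) (A : Subalgebra k K), (∀ c : k, algebraMap k K c ∈ O) →
        A.FG → IsFractionRing ↥A K → A.toSubring ≤ O.toSubring →
        (∀ O' : ValuationSubring K,
          (∀ m : ℕ, ∀ s ∈ tower O A m, s ∈ O' ∧ (s⁻¹ ∈ O' → s⁻¹ ∈ O)) → ¬ IsNoetherianRing ↥O') →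
        (∀ O' : ValuationSubring K, O < O' → ∃ m : ℕ, ∃ s ∈ tower O A m, s⁻¹ ∈ O' ∧ s⁻¹ ∉ O) →
        (∀ (k' K' : Type) [Field k'] [CharP k' p] [Field K'] [Algebra k' K'] (O' : ValuationSubring K')
          (A' : Subalgebra k' K'), (∀ c : k', algebraMap k' K' c ∈ O') → A'.FG → IsFractionRing ↥A' K' →
          A'.toSubring ≤ O'.toSubring → Algebra.trdeg k' K' < Algebra.trdeg k K →
          ∃ m : ℕ, IsRegularLocalRing ↥(tower O' A' m)) →
        (∀ m : ℕ, ∀ s ∈ tower O A m, ∃ f : Polynomial k, f ≠ 0 ∧ O.valuation (Polynomial.aeval s f) < 1) →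
        3 ≤ Algebra.trdeg k K →
        (∀ O₁ : ValuationSubring K, O < O₁ → O₁ = ⊤) →
        ¬ (∃ W : ValuationSubring K, ∃ m₁ : ℕ, (∀ s ∈ tower O A m₁, s ∈ W) ∧
        (∃ s ∈ tower O A m₁, s⁻¹ ∈ W ∧ s⁻¹ ∉ O) ∧ (∃ t ∈ tower O A m₁, t ≠ 0 ∧ t⁻¹ ∉ W) ∧
        ∀ m : ℕ, m₁ ≤ m → tower O A m ≤ loc W (tower O A m₁)) →
        ¬ SingularPrimeThread O A →
        ∀ x : K, x ∈ O → ∃ m : ℕ, x ∈ tower O A m)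
    (h₂ :
      PersistenceRadical → StrictDrop → ∀ p : ℕ, p.Prime → ∀ (k K : Type) [Field k] [CharP k p] [Field K]
        [Algebra k K] (O : ValuationSubring K) (A : Subalgebra k K), (∀ c : k, algebraMap k K c ∈ O) →
        A.FG → IsFractionRing ↥A K → A.toSubring ≤ O.toSubring →
        (∀ O' : ValuationSubring K,
          (∀ m : ℕ, ∀ s ∈ tower O A m, s ∈ O' ∧ (s⁻¹ ∈ O' → s⁻¹ ∈ O)) → ¬ IsNoetherianRing ↥O') →
        (∀ O' : ValuationSubring K, O < O' → ∃ m : ℕ, ∃ s ∈ tower O A m, s⁻¹ ∈ O' ∧ s⁻¹ ∉ O) →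
        (∀ (k' K' : Type) [Field k'] [CharP k' p] [Field K'] [Algebra k' K'] (O' : ValuationSubring K')
          (A' : Subalgebra k' K'), (∀ c : k', algebraMap k' K' c ∈ O') → A'.FG → IsFractionRing ↥A' K' →
          A'.toSubring ≤ O'.toSubring → Algebra.trdeg k' K' < Algebra.trdeg k K →
          ∃ m : ℕ, IsRegularLocalRing ↥(tower O' A' m)) →
        (∀ m : ℕ, ∀ s ∈ tower O A m, ∃ f : Polynomial k, f ≠ 0 ∧ O.valuation (Polynomial.aeval s f) < 1) →
        3 ≤ Algebra.trdeg k K →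
        (∀ O₁ : ValuationSubring K, O < O₁ → O₁ = ⊤) →
        (∀ x : K, x ∈ O → ∃ m : ℕ, x ∈ tower O A m) →
        ¬ SingularPrimeThread O A →
        ∃ m : ℕ, IsRegularLocalRing ↥(tower O A m))
    (h₃ :
      PersistenceRadical → StrictDrop → ∀ p : ℕ, p.Prime → ∀ (k K : Type) [Field k] [CharP k p] [Field K]
        [Algebra k K] (O : ValuationSubring K) (A : Subalgebra k K), (∀ c : k, algebraMap k K c ∈ O) →
        A.FG → IsFractionRing ↥A K → A.toSubring ≤ O.toSubring →
        (∀ O' : ValuationSubring K,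
          (∀ m : ℕ, ∀ s ∈ tower O A m, s ∈ O' ∧ (s⁻¹ ∈ O' → s⁻¹ ∈ O)) → ¬ IsNoetherianRing ↥O') →
        (∀ O' : ValuationSubring K, O < O' → ∃ m : ℕ, ∃ s ∈ tower O A m, s⁻¹ ∈ O' ∧ s⁻¹ ∉ O) →
        (∀ (k' K' : Type) [Field k'] [CharP k' p] [Field K'] [Algebra k' K'] (O' : ValuationSubring K')
          (A' : Subalgebra k' K'), (∀ c : k', algebraMap k' K' c ∈ O') → A'.FG → IsFractionRing ↥A' K' →
          A'.toSubring ≤ O'.toSubring → Algebra.trdeg k' K' < Algebra.trdeg k K →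
          ∃ m : ℕ, IsRegularLocalRing ↥(tower O' A' m)) →
        (∀ m : ℕ, ∀ s ∈ tower O A m, ∃ f : Polynomial k, f ≠ 0 ∧ O.valuation (Polynomial.aeval s f) < 1) →
        3 ≤ Algebra.trdeg k K →
        (∀ O₁ : ValuationSubring K, O < O₁ → O₁ = ⊤) →
        (∃ t : K, t ∈ O ∧ (∀ m : ℕ, t ∉ tower O A m) ∧
          ∀ f : Polynomial k, f ≠ 0 → ¬ O.valuation (Polynomial.aeval t f) < 1) →
        ¬ SingularPrimeThread O A →
        ∀ (W : ValuationSubring K) (m₁ : ℕ), (∀ s ∈ tower O A m₁, s ∈ W) →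
        (∃ s ∈ tower O A m₁, s⁻¹ ∈ W ∧ s⁻¹ ∉ O) → (∃ t ∈ tower O A m₁, t ≠ 0 ∧ t⁻¹ ∉ W) →
        (∀ m : ℕ, m₁ ≤ m → tower O A m ≤ loc W (tower O A m₁)) →
        (∀ m : ℕ, ∀ s ∈ tower O A m, s ∈ W) →
        (∃ a ∈ tower O A m₁, ∃ b ∈ tower O A m₁, ∀ f : MvPolynomial (Fin 2) k, f ≠ 0 →
          W.valuation (MvPolynomial.aeval ![a, b] f) = 1) →
        (∃ U : ValuationSubring K, U ≤ W ∧ ∀ m : ℕ, ∀ s ∈ tower O A m, s ∈ U ∧ (s⁻¹ ∈ U → s⁻¹ ∈ O)) →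
        (∀ (U : ValuationSubring K) (hUW : U ≤ W),
          (∀ m : ℕ, ∀ s ∈ tower O A m, s ∈ U ∧ (s⁻¹ ∈ U → s⁻¹ ∈ O)) →
          ¬ IsNoetherianRing ↥(residueValuationSubring U W hUW) ∧
          ∀ (W₂ : ValuationSubring K) (hkW₂ : ∀ c : k, algebraMap k K c ∈ W₂), U < W₂ → W₂ < W →
            (letI : Algebra k ↥W₂ := algebraOfMem k W₂ hkW₂; Algebra.trdeg k (ResidueField ↥W₂) ≤ 1) →
            ∀ m : ℕ, ∀ s ∈ tower O A m, s⁻¹ ∈ W₂ → s⁻¹ ∈ O) →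
        ∃ m : ℕ, IsRegularLocalRing ↥(tower O A m))
    (_hF : (CossartJannsenSaito2020General.{0} ∧ Lipman1969_1_2.{0} ∧ Lipman1969_4_1.{0} ∧ Lipman1969_12_1_i.{0} ∧
        Lipman1969_12_1_ii.{0} ∧ Literature.AlgebraicGeometry.Morphisms.GortzWedhorn2023_24_44_H2.{0}) ∧
      (Lipman1969_16_1_ii.{0} ∧ Lipman1969_16_5.{0} ∧ Lipman1969_27_1_reg_rat.{0} ∧ Lipman1969_27_3_rat.{0})) :
    PersistenceRadical → StrictDrop → ∀ p : ℕ, p.Prime → ∀ (k K : Type) [Field k] [CharP k p] [Field K]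
      [Algebra k K] (O : ValuationSubring K) (A : Subalgebra k K), (∀ c : k, algebraMap k K c ∈ O) →
      A.FG → IsFractionRing ↥A K → A.toSubring ≤ O.toSubring →
      (∀ O' : ValuationSubring K,
        (∀ m : ℕ, ∀ s ∈ tower O A m, s ∈ O' ∧ (s⁻¹ ∈ O' → s⁻¹ ∈ O)) → ¬ IsNoetherianRing ↥O') →
      (∀ O' : ValuationSubring K, O < O' → ∃ m : ℕ, ∃ s ∈ tower O A m, s⁻¹ ∈ O' ∧ s⁻¹ ∉ O) →
      (∀ (k' K' : Type) [Field k'] [CharP k' p] [Field K'] [Algebra k' K'] (O' : ValuationSubring K')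
        (A' : Subalgebra k' K'), (∀ c : k', algebraMap k' K' c ∈ O') → A'.FG → IsFractionRing ↥A' K' →
        A'.toSubring ≤ O'.toSubring → Algebra.trdeg k' K' < Algebra.trdeg k K →
        ∃ m : ℕ, IsRegularLocalRing ↥(tower O' A' m)) →
      (∀ m : ℕ, ∀ s ∈ tower O A m, ∃ f : Polynomial k, f ≠ 0 ∧ O.valuation (Polynomial.aeval s f) < 1) →
      3 ≤ Algebra.trdeg k K →
      (∀ O₁ : ValuationSubring K, O < O₁ → O₁ = ⊤) →
      ((∀ x : K, x ∈ O → ∃ m : ℕ, x ∈ tower O A m) ∨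
        (∃ t : K, t ∈ O ∧ (∀ m : ℕ, t ∉ tower O A m) ∧
          ∀ f : Polynomial k, f ≠ 0 → ¬ O.valuation (Polynomial.aeval t f) < 1)) →
      ¬ SingularPrimeThread O A →
      ∃ m : ℕ, IsRegularLocalRing ↥(tower O A m) :=
  beta1RankOneSharp_of_split h₁ h₂ (beta1SharpConfined_of_sharp h₃)

end Summit.ResolutionOfSingularities.ResolutionOfSingularities.Theorems.NoZeno.ConfinedSurface

end
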